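import Summits.ResolutionOfSingularities.ResolutionOfSingularities.Theorems.WeightedInvariantIota3LemmaCPrimeCore
import Summits.ResolutionOfSingularities.ResolutionOfSingularities.Theorems.WeightedInvariantKeyRungThreeOfLemmaCPrime
import HarnessLib

/-!
# LEMMA C′ PROVED: the bridge `κ[X₀, X₁, X₂] → κ[X][V][Y]` and the gap list of `stub_keyRungGrHomLE_three` with LEMMA C′ discharged
# (door `HypersurfaceCentreConstruction`, stmt-ResolutionOfSingularities-19897; memo RESIDUE-PLAN.md §3b/§4)

Helper for `stub_keyRungGrHomLE_three` (def-free, `--supports 19897`).  The `κ`-algebra map `β : κ[X₀,X₁,X₂] → κ[X][V][Y]`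
(`X₀ ↦ X`, `X₁ ↦ V`, `X₂ ↦ Y`) is injective (`toIter_injective`, explicit left inverse), carries a polynomial free of `X₂` to a
constant (`toIter_eq_C_of_no_X₂`), intertwines the substitution `X₁ ↦ X₁ + εX₀^j, X₂ ↦ X₂ + τ` with `P ↦ taylor τ̂ (P.map (taylor T))`
(`toIter_aeval`), and carries a PURE `Φ` (monomials `X₁^{e₁}X₂^{e₂}`, `r₁e₂ + r₂e₁ = r₁ν`) to a pure `P` in the sense of
…Iota3LemmaCPrimeVanishing (`coeff_toIter_pure`).  Hence **`lemmaC'`** = LEMMA C′ verbatim (hypothesis `hC'` of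
`keyRungGrHomLE_three_of_lemmaC'`, from `LemmaCPrime.core`), and the GAP LIST OF RECORD shrinks to **`keyRungGrHomLE_three_of_game`**:
`KeyRungGrHomLE 3 p` from hD (desc-τ as typed; door-proved) and hgame alone — the dominance residue hres₃ / (INV)₃ / LEMMA C are
fully discharged.
[OURS · L1 W4.3 · (o70-b)/(Δ12); AI work, weaker than expert review; nothing here is a statement of the manuscript under review.]
-/

noncomputable section

set_option linter.dupNamespace false -- mandated namespace of this single-conjunct summit

namespace Summit.ResolutionOfSingularities.ResolutionOfSingularities.Cruxes.HypersurfaceCentreConstruction.LocalEngine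

namespace Iota3

namespace LemmaCPrime

section Bridge

open Polynomial

variable {κ : Type} [Field κ]

/-- The images of the three variables under the bridge `β : κ[X₀,X₁,X₂] → κ[X][V][Y]`. [folklore] -/
theorem toIter_X (i : Fin 3) :
    (MvPolynomial.aeval (R := κ) (![C (C X), C X, X] : Fin 3 → κ[X][X][X])) (MvPolynomial.X i : MvPolynomial (Fin 3) κ) =
      (![C (C X), C X, X] : Fin 3 → κ[X][X][X]) i :=
  MvPolynomial.aeval_X _ i

/-- The bridge on constants: `β (C a) = C (C (C a))`. [folklore] -/
theorem toIter_C (a : κ) :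
    (MvPolynomial.aeval (R := κ) (![C (C X), C X, X] : Fin 3 → κ[X][X][X])) (MvPolynomial.C a) = C (C (C a)) := by
  rw [MvPolynomial.aeval_C, Polynomial.algebraMap_apply, Polynomial.algebraMap_apply, Polynomial.algebraMap_apply,
    Algebra.algebraMap_self_apply]

/-- The bridge on monomials: `β (a X₀^{e₀} X₁^{e₁} X₂^{e₂}) = C(C(C a)) · (C (C X))^{e₀} · (C X)^{e₁} · Y^{e₂}`. [folklore] -/
theorem toIter_monomial (e : Fin 3 →₀ ℕ) (a : κ) :
    (MvPolynomial.aeval (R := κ) (![C (C X), C X, X] : Fin 3 → κ[X][X][X])) (MvPolynomial.monomial e a) =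
      C (C (C a)) * (C (C X) ^ (e 0) * C X ^ (e 1) * X ^ (e 2)) := by
  rw [MvPolynomial.aeval_monomial, Finsupp.prod_fintype _ _ (by simp), Fin.prod_univ_three, Polynomial.algebraMap_apply,
    Polynomial.algebraMap_apply, Polynomial.algebraMap_apply, Algebra.algebraMap_self_apply]
  rfl

/-- **The bridge is injective** (explicit left inverse `Y ↦ X₂`, `V ↦ X₁`, `X ↦ X₀`). [folklore] -/
theorem toIter_injective :
    Function.Injective ((MvPolynomial.aeval (R := κ) (![C (C X), C X, X] : Fin 3 → κ[X][X][X]))) := by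
  set γ₀ : κ[X] →+* MvPolynomial (Fin 3) κ := eval₂RingHom MvPolynomial.C (MvPolynomial.X 0) with hγ₀
  set γ₁ : κ[X][X] →+* MvPolynomial (Fin 3) κ := eval₂RingHom γ₀ (MvPolynomial.X 1) with hγ₁
  set γ : κ[X][X][X] →+* MvPolynomial (Fin 3) κ := eval₂RingHom γ₁ (MvPolynomial.X 2) with hγ
  have hcomp : γ.comp ((MvPolynomial.aeval (R := κ) (![C (C X), C X, X] : Fin 3 → κ[X][X][X]))).toRingHom = RingHom.id _ := by
    refine MvPolynomial.ringHom_ext (fun a => ?_) (fun i => ?_)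
    · rw [RingHom.comp_apply, RingHom.id_apply, AlgHom.toRingHom_eq_coe, AlgHom.coe_toRingHom, toIter_C, hγ,
        coe_eval₂RingHom, eval₂_C, hγ₁, coe_eval₂RingHom, eval₂_C, hγ₀, coe_eval₂RingHom, eval₂_C]
    · rw [RingHom.comp_apply, RingHom.id_apply, AlgHom.toRingHom_eq_coe, AlgHom.coe_toRingHom, toIter_X]
      fin_cases i
      · show γ (C (C X)) = MvPolynomial.X 0
        rw [hγ, coe_eval₂RingHom, eval₂_C, hγ₁, coe_eval₂RingHom, eval₂_C, hγ₀, coe_eval₂RingHom, eval₂_X]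
      · show γ (C X) = MvPolynomial.X 1
        rw [hγ, coe_eval₂RingHom, eval₂_C, hγ₁, coe_eval₂RingHom, eval₂_X]
      · show γ X = MvPolynomial.X 2
        rw [hγ, coe_eval₂RingHom, eval₂_X]
  intro Φ Ψ h
  have h1 := congr_arg γ h
  have hΦ := RingHom.congr_fun hcomp Φ
  have hΨ := RingHom.congr_fun hcomp Ψ
  rw [RingHom.comp_apply, AlgHom.toRingHom_eq_coe, AlgHom.coe_toRingHom, RingHom.id_apply] at hΦ hΨ
  rwa [hΦ, hΨ] at h1

/-- **A polynomial free of `X₂` goes to a constant of `κ[X][V][Y]`**: `β τ = C τ̂` with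
`τ̂ = τ(C X, X, 0) ∈ κ[X][V]`. [folklore] -/
theorem toIter_eq_C_of_no_X₂ {τ : MvPolynomial (Fin 3) κ} (hτ : ∀ e ∈ τ.support, e 2 = 0) :
    (MvPolynomial.aeval (R := κ) (![C (C X), C X, X] : Fin 3 → κ[X][X][X])) τ =
      C ((MvPolynomial.aeval (R := κ) (![C X, X, 0] : Fin 3 → κ[X][X])) τ) := by
  classical
  conv_lhs => rw [τ.as_sum]
  conv_rhs => rw [τ.as_sum]
  rw [map_sum, map_sum, map_sum]
  refine Finset.sum_congr rfl fun e he => ?_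
  rw [toIter_monomial, MvPolynomial.aeval_monomial, Finsupp.prod_fintype _ _ (by simp), Fin.prod_univ_three,
    Polynomial.algebraMap_apply, Polynomial.algebraMap_apply, Algebra.algebraMap_self_apply, hτ e he, pow_zero, pow_zero, mul_one,
    mul_one]
  show C (C (C (MvPolynomial.coeff e τ))) * (C (C X) ^ (e 0) * C X ^ (e 1)) = C (C (C (MvPolynomial.coeff e τ)) * (C X ^ (e 0) * X ^ (e 1)))
  rw [map_mul, map_mul, map_pow, map_pow]

/-- **The bridge intertwines the functional-equation substitution with `P ↦ taylor τ̂ (P.map (taylor T))`**, `T = εX^j`. [folklore] -/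
theorem toIter_aeval (ε : κ) (j : ℕ) {τ : MvPolynomial (Fin 3) κ} (hτ : ∀ e ∈ τ.support, e 2 = 0)
    (Φ : MvPolynomial (Fin 3) κ) :
    (MvPolynomial.aeval (R := κ) (![C (C X), C X, X] : Fin 3 → κ[X][X][X]))
        (MvPolynomial.aeval ![MvPolynomial.X 0, MvPolynomial.X 1 + MvPolynomial.C ε * MvPolynomial.X 0 ^ j,
          MvPolynomial.X 2 + τ] Φ) =
      taylor ((MvPolynomial.aeval (R := κ) (![C X, X, 0] : Fin 3 → κ[X][X])) τ)
        (((MvPolynomial.aeval (R := κ) (![C (C X), C X, X] : Fin 3 → κ[X][X][X])) Φ).map (taylorAlgHom (C ε * X ^ j)).toRingHom) := by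
  set β := (MvPolynomial.aeval (R := κ) (![C (C X), C X, X] : Fin 3 → κ[X][X][X])) with hβ
  set τ' := (MvPolynomial.aeval (R := κ) (![C X, X, 0] : Fin 3 → κ[X][X])) τ with hτ'
  set T : κ[X] := C ε * X ^ j with hT
  set S : κ[X][X][X] →+* κ[X][X][X] := (taylorAlgHom τ').toRingHom.comp (mapRingHom (taylorAlgHom T).toRingHom) with hS
  have hσ : ∀ f : κ[X][X], (taylorAlgHom T).toRingHom f = taylor T f := fun f => rfl
  have hSapp : ∀ Q : κ[X][X][X], S Q = taylor τ' (Q.map (taylorAlgHom T).toRingHom) := fun Q => rfl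
  have key : (β.toRingHom.comp (MvPolynomial.aeval ![MvPolynomial.X 0, MvPolynomial.X 1 + MvPolynomial.C ε * MvPolynomial.X 0 ^ j,
      MvPolynomial.X 2 + τ]).toRingHom) = S.comp β.toRingHom := by
    refine MvPolynomial.ringHom_ext (fun a => ?_) (fun i => ?_)
    · rw [RingHom.comp_apply, RingHom.comp_apply, AlgHom.toRingHom_eq_coe, AlgHom.coe_toRingHom, AlgHom.toRingHom_eq_coe,
        AlgHom.coe_toRingHom, MvPolynomial.aeval_C, MvPolynomial.algebraMap_eq, hβ, toIter_C, hSapp, Polynomial.map_C, hσ,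
        taylor_C, taylor_C]
    · rw [RingHom.comp_apply, RingHom.comp_apply, AlgHom.toRingHom_eq_coe, AlgHom.coe_toRingHom, AlgHom.toRingHom_eq_coe,
        AlgHom.coe_toRingHom, MvPolynomial.aeval_X, hSapp, hβ, toIter_X]
      fin_cases i
      · show β (MvPolynomial.X 0) = taylor τ' ((C (C X) : κ[X][X][X]).map (taylorAlgHom T).toRingHom)
        rw [hβ, toIter_X, Polynomial.map_C, hσ, taylor_C, taylor_C]; rfl
      · show β (MvPolynomial.X 1 + MvPolynomial.C ε * MvPolynomial.X 0 ^ j) = taylor τ' ((C X : κ[X][X][X]).map (taylorAlgHom T).toRingHom)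
        rw [map_add, map_mul, map_pow, hβ, toIter_X, toIter_X, toIter_C, Polynomial.map_C, hσ, taylor_X, taylor_C]
        show (C X : κ[X][X][X]) + C (C (C ε)) * C (C X) ^ j = C (X + C (C ε * X ^ j))
        rw [map_add, map_mul, map_mul, map_pow, map_pow]
      · show β (MvPolynomial.X 2 + τ) = taylor τ' ((X : κ[X][X][X]).map (taylorAlgHom T).toRingHom)
        rw [map_add, hβ, toIter_X, toIter_eq_C_of_no_X₂ hτ, Polynomial.map_X, taylor_X]; rfl
  have h := RingHom.congr_fun key Φ
  rw [RingHom.comp_apply, RingHom.comp_apply, AlgHom.toRingHom_eq_coe, AlgHom.coe_toRingHom, AlgHom.toRingHom_eq_coe,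
    AlgHom.coe_toRingHom, hSapp] at h
  exact h

/-- An exponent with `e₀ = 0` is `single 1 (e 1) + single 2 (e 2)`. [folklore] -/
theorem eq_single_add_single_of_no_X₀ {e : Fin 3 →₀ ℕ} (h0 : e 0 = 0) :
    e = Finsupp.single 1 (e 1) + Finsupp.single 2 (e 2) := by
  ext i; fin_cases i <;> simp [h0]

/-- **The bridge carries a pure `Φ` to a pure `P`**: with `e_c := r₁(ν − c)/r₂` and `λ_c := Φ_{(0, e_c, c)}`,
`coeff_c (β Φ) = λ_c V^{e_c}`. [folklore] -/
theorem coeff_toIter_pure {r₁ r₂ ν : ℕ} (hr₂ : 0 < r₂) {Φ : MvPolynomial (Fin 3) κ}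
    (hΦ : ∀ e ∈ Φ.support, e 0 = 0 ∧ r₁ * e 2 + r₂ * e 1 = r₁ * ν) (c : ℕ) :
    ((MvPolynomial.aeval (R := κ) (![C (C X), C X, X] : Fin 3 → κ[X][X][X])) Φ).coeff c =
      monomial (r₁ * (ν - c) / r₂)
        (C (MvPolynomial.coeff (Finsupp.single 1 (r₁ * (ν - c) / r₂) + Finsupp.single 2 c) Φ)) := by
  classical
  set s : Fin 3 →₀ ℕ := Finsupp.single 1 (r₁ * (ν - c) / r₂) + Finsupp.single 2 c with hs
  have hs1 : s 1 = r₁ * (ν - c) / r₂ := by simp [hs]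
  have hs2 : s 2 = c := by simp [hs]
  have hterm : ∀ e ∈ Φ.support, ((MvPolynomial.aeval (R := κ) (![C (C X), C X, X] : Fin 3 → κ[X][X][X]))
      (MvPolynomial.monomial e (MvPolynomial.coeff e Φ))).coeff c =
      if e 2 = c then monomial (e 1) (C (MvPolynomial.coeff e Φ)) else 0 := by
    intro e he
    rw [toIter_monomial, (hΦ e he).1, pow_zero, one_mul, ← map_pow, ← mul_assoc, ← map_mul, coeff_C_mul_X_pow,
      C_mul_X_pow_eq_monomial]
    split_ifs with h1 h2 h2
    · rfl
    · exact absurd h1.symm h2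
    · exact absurd h2.symm h1
    · rfl
  conv_lhs => rw [Φ.as_sum]
  rw [map_sum, finsetSum_coeff, Finset.sum_congr rfl hterm, Finset.sum_eq_single s]
  · rw [if_pos hs2, hs1]
  · intro e he hne
    rw [if_neg]
    intro he2
    apply hne
    obtain ⟨h0, hw⟩ := hΦ e he
    have he1 : e 1 = r₁ * (ν - c) / r₂ := by
      rw [he2] at hw
      have h3 : r₂ * e 1 = r₁ * ν - r₁ * c := by omega
      rw [Nat.mul_sub, ← h3, Nat.mul_div_cancel_left _ hr₂]
    rw [eq_single_add_single_of_no_X₀ h0, he1, he2]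
  · intro hns
    rw [if_pos hs2, MvPolynomial.notMem_support_iff.mp hns, map_zero, map_zero]

end Bridge

section Statement

open MvPolynomial

/-- **LEMMA C′** (hypothesis `hC'` of `keyRungGrHomLE_three_of_lemmaC'`, RESIDUE-PLAN.md §3b).  For a field `κ`, `0 < r₂ < r₁`,
`1 ≤ j`, `1 ≤ ν`: a pure `Φ ∈ κ[X₁,X₂]` (monomials `X₁^{e₁}X₂^{e₂}`, `r₁e₂ + r₂e₁ = r₁ν`) with `X₂^ν ∈ supp Φ`, fixed by the substitution
`X₁ ↦ X₁ + εX₀^j`, `X₂ ↦ X₂ + τ` (`ε ≠ 0`, `τ` free of `X₂`), is `u (X₂ − a X₁^{r₁/r₂})^ν` with `a ≠ 0` only if `r₂ ∣ r₁`.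
(Bridge to `κ[X][V][Y]` + `LemmaCPrime.core`.) [OURS · L1 W4.3 · (o70-b)/(Δ12)] -/
theorem lemmaC' {κ : Type} [Field κ] {r₁ r₂ j ν : ℕ} (hr₂ : 0 < r₂) (hr : r₂ < r₁) (hj : 1 ≤ j) (hν : 1 ≤ ν)
    (Φ : MvPolynomial (Fin 3) κ) (ε : κ) (τ : MvPolynomial (Fin 3) κ)
    (hΦ : ∀ e ∈ Φ.support, e 0 = 0 ∧ r₁ * e 2 + r₂ * e 1 = r₁ * ν) (hΦν : Φ.coeff (Finsupp.single 2 ν) ≠ 0) (hε : ε ≠ 0)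
    (hτ : ∀ e ∈ τ.support, e 2 = 0) (hfe : Φ = aeval ![X 0, X 1 + C ε * X 0 ^ j, X 2 + τ] Φ) :
    ∃ u a : κ, Φ = C u * (X 2 - C a * X 1 ^ (r₁ / r₂)) ^ ν ∧ (a ≠ 0 → r₂ ∣ r₁) := by
  classical
  set β := (MvPolynomial.aeval (R := κ) (![Polynomial.C (Polynomial.C Polynomial.X), Polynomial.C Polynomial.X, Polynomial.X] :
    Fin 3 → Polynomial (Polynomial (Polynomial κ)))) with hβ
  set P := β Φ with hP
  set τ' := (MvPolynomial.aeval (R := κ) (![Polynomial.C Polynomial.X, Polynomial.X, 0] : Fin 3 → Polynomial (Polynomial κ))) τ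
    with hτ'
  set ex : ℕ → ℕ := fun c => r₁ * (ν - c) / r₂ with hex
  set lam : ℕ → κ := fun c => Φ.coeff (Finsupp.single 1 (ex c) + Finsupp.single 2 c) with hlam
  have hPc : ∀ c, P.coeff c = Polynomial.monomial (ex c) (Polynomial.C (lam c)) := fun c => coeff_toIter_pure hr₂ hΦ c
  have hexc : ∀ c, lam c ≠ 0 → c ≤ ν ∧ r₂ * ex c = r₁ * (ν - c) := by
    intro c hc
    have hmem : Finsupp.single 1 (ex c) + Finsupp.single 2 c ∈ Φ.support := MvPolynomial.mem_support_iff.mpr hc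
    obtain ⟨_, hw⟩ := hΦ _ hmem
    simp only [Finsupp.coe_add, Pi.add_apply, Finsupp.single_apply] at hw
    simp only [Fin.isValue, Fin.reduceEq, ↓reduceIte, zero_add, add_zero] at hw
    have hcν : c ≤ ν := Nat.le_of_mul_le_mul_left (by omega : r₁ * c ≤ r₁ * ν) (by omega)
    refine ⟨hcν, ?_⟩
    rw [Nat.mul_sub]; omega
  have hlamν : lam ν ≠ 0 := by
    show Φ.coeff (Finsupp.single 1 (ex ν) + Finsupp.single 2 ν) ≠ 0
    have : ex ν = 0 := by simp [hex]
    rwa [this, Finsupp.single_zero, zero_add]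
  have hfeP : P = Polynomial.taylor τ' (P.map (Polynomial.taylorAlgHom (Polynomial.C ε * Polynomial.X ^ j)).toRingHom) := by
    rw [hP, hτ', hβ, ← toIter_aeval ε j hτ Φ, ← hfe]
  obtain ⟨a, hPeq, hadvd⟩ := core hε hj ν r₁ r₂ lam ex P τ' hr₂ hr hν hPc hexc hlamν hfeP
  refine ⟨lam ν, a, toIter_injective ?_, hadvd⟩
  have hR : β (C (lam ν) * (X 2 - C a * X 1 ^ (r₁ / r₂)) ^ ν) =
      Polynomial.C (Polynomial.C (Polynomial.C (lam ν))) *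
        (Polynomial.X - Polynomial.C (Polynomial.C (Polynomial.C a)) * Polynomial.C Polynomial.X ^ (r₁ / r₂)) ^ ν := by
    rw [map_mul, map_pow, map_sub, map_mul, map_pow, hβ, toIter_C, toIter_C, toIter_X, toIter_X]; rfl
  rw [hR, ← hP, hPeq, map_mul, map_pow]

end Statement

end LemmaCPrime

end Iota3

open IsLocalRing Literature.AlgebraicGeometry.Resolution MvPolynomial
open Summit.ResolutionOfSingularities.ResolutionOfSingularities.Theorems

open Iota3 in
/-- **GAP LIST OF RECORD for `stub_keyRungGrHomLE_three` — hD, hgame (LEMMA C′ DISCHARGED).**  `KeyRungGrHomLE 3 p` from hD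
(desc-τ as typed; door-proved) and hgame alone: `keyRungGrHomLE_three_of_lemmaC'` with its hypothesis LEMMA C′ supplied by
`LemmaCPrime.lemmaC'`.  The dominance residue hres₃, the invariance (INV)₃ and LEMMA C of the earlier gap lists are thereby proved
outright. [OURS · L1 W4.3 · audit glue] -/
theorem keyRungGrHomLE_three_of_game (p : ℕ)
    (hD : ∀ (T T' : Type) [CommRing T] [IsRegularLocalRing T] [CommRing T'] [IsRegularLocalRing T'] [Algebra T T']
      [IsLocalHom (algebraMap T T')] [Algebra.FormallySmooth T T'] [Algebra.EssFiniteType T T'] (g : T),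
      ringKrullDim T' ≤ 3 → Iota3.IsTiePosition T' (algebraMap T T' g) →
        Iota3.IsTiePosition T g)
    (hgame : CanonicalGameClauseHomLE 3 p iotaFlatT jFlatT) :
    KeyRungGrHomLE 3 p :=
  keyRungGrHomLE_three_of_lemmaC' p hD hgame
    (fun _ _ _ _ _ _ hr₂ hr hj hν Φ ε τ hΦ hΦν hε hτ hfe => LemmaCPrime.lemmaC' hr₂ hr hj hν Φ ε τ hΦ hΦν hε hτ hfe)

end Summit.ResolutionOfSingularities.ResolutionOfSingularities.Cruxes.HypersurfaceCentreConstruction.LocalEngine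

end
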